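import Summits.BirchSwinnertonDyer.Rank1Residual.X2.GreenbergVatsalStrictSelmer
import Literature.NumberTheory.EllipticCurves.Greenberg1999.KummerImageGoodOrdinaryNumberField
import Literature.NumberTheory.EllipticCurves.TateCurve.NumberFieldUniformizationKernelOfReduction
import Literature.NumberTheory.GaloisRepresentations.DiscreteValuationDivisibleUnits
import HarnessLib

/-!
# KS(v) at a SPLIT multiplicative place `v ∣ p`: `Im κ ⊆ Im λ` for Greenberg's `C_v = E[p^∞] ∩ E₁(K̄_v)`
# — the local inclusion `localKerOver ≤ strictKer` of the kernel-of-reduction datum, PROVED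
# (Greenberg LNM 1716 §2 p. 76 «verified quite directly by using the Tate parametrization»)

LEAD `bsd-wall-utd-p1` (g26), crux r205 stmt-BirchSwinnertonDyer-24737
`UniversalToricDescent.TwinAlgMuZeroAtThree`, line `beta-road` v10, K2 stub `stub_howardOutputsOfFamily`,
residue item (c) «readout/LINK at `v ∣ 3`»: the hypothesis `hKS`
(`localKerOver 3 (ker κ) K_v ≤ (kernelOfReductionLocalDatum 3 v).strictKer (ker κ)`) of the twin's readout
`ZpExtensionEisensteinReadoutOrdinaryLocalKummerStrictMultiplicativeThreeProofs` (p760847), discharged at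
every SPLIT multiplicative `v ∣ p` (any number field `K : Type`, any prime `p`, any subgroup `H ≤ Γ_K`).

Proof («Tate-reduction adapter»): by `TateCurve.exists_tateUniformisation_localKernelOfReduction`
(Silverman ATAEC V.5.3/V.3.1 PLUS §V.4's `Φ(1 + 𝔪) ⊆ E₁(K̄_v)`, proved) a `p`-power torsion point of the
form `σP − P` (`σ ∈ Γ_{K_v}`, `P ∈ E(K̄_v)`) is `Φ(ζ)` with `ζ = σu/u` a unit whose `p^k`-th power lies
in `q^ℤ`, hence `ζ^{p^k} = 1` (`|q|_v < 1`; X2's `tateDatum_kummer_all` argument); a `p`-power root of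
unity is a principal unit at residue characteristic `p` (tree
`valuation_sub_one_lt_one_of_pow_prime_pow`), so `Φ(ζ) ∈ E₁(K̄_v)`, i.e. `σP − P ∈ C_v`: the all-`σ`
Kummer compatibility `hN` of X2's `localKerOver_le_strictKer_of_kummer_all`, which then gives
`localKerOver p H K_v ≤ (kernelOfReductionLocalDatum p v).strictKer H` for every `H`.

* `kummer_all_kernelOfReductionLocalDatum_of_hasSplitMultiplicativeReductionAt` — `σP − P ∈ E[p^∞] ⟹ σP − P ∈ E₁(K̄_v)`;
* **`localKerOver_le_strictKer_kernelOfReduction_of_hasSplitMultiplicativeReductionAt`** — KS(v).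

The NON-split case (`p` odd: restriction to the index-`2` subgroup fixing `√γ`) is not in this file.
BSD is proved for no curve by any of this; 24737 stays OPEN.
-/

set_option autoImplicit false
-- the summit and its single problem are both named `BirchSwinnertonDyer` (registry layout D-0017)
set_option linter.dupNamespace false

noncomputable section

open scoped Classical NNReal

namespace Summit.BirchSwinnertonDyer.BirchSwinnertonDyer.Theorems.UniversalToricDescentKummerStrictSplitMultiplicative

open NumberField IsDedekindDomain Field WeierstrassCurve
open Literature.NumberTheory.EllipticCurves Literature.NumberTheory.EllipticCurves.GreenbergSelmer
  Literature.NumberTheory.GaloisRepresentations IsDedekindDomain.HeightOneSpectrum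
  Literature.NumberTheory.EllipticCurves.TateCurve
  Summit.BirchSwinnertonDyer.Rank1Residual.X2.GreenbergVatsalStrictSelmer

variable {K : Type} [Field K] [NumberField K] (W : WeierstrassCurve K) [W.IsElliptic]
  (p : ℕ) [hp : Fact p.Prime] {v : HeightOneSpectrum (𝓞 K)}

/-- **At a SPLIT multiplicative `v ∣ p`, a `p`-power torsion point of the form `σP − P`
(`σ ∈ Γ_{K_v}`, `P ∈ E(K̄_v)`) lies in the kernel of reduction `E₁(K̄_v)`** — the all-`σ` Kummer
compatibility (`hN` of X2's `localKerOver_le_strictKer_of_kummer_all`) of Greenberg's datum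
`C_v = E[p^∞] ∩ E₁(K̄_v)` (`WeierstrassCurve.kernelOfReductionLocalDatum`): `σP − P = Φ(σu/u)` with
`(σu/u)^{p^k} ∈ q^ℤ ∩ 𝒪^× = 1`, and a `p`-power root of unity is a principal unit, mapped into `E₁`
by ATAEC §V.4. [cite: GreenbergLNM1716, §2 pp. 73, 76] [cite: SilvermanATAEC1994, Thm. V.3.1 (c),(d), §V.4, Thm. V.5.3] -/
theorem kummer_all_kernelOfReductionLocalDatum_of_hasSplitMultiplicativeReductionAt
    (hpv : ((p : ℕ) : 𝓞 K) ∈ v.asIdeal) (hsplit : W.HasSplitMultiplicativeReductionAt v) :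
    ∀ (σ : absoluteGaloisGroup (v.adicCompletion K)) (P : localPoints W (v.adicCompletion K))
      (m : W.geomPrimaryTorsion p),
      pointsMap W (v.adicCompletion K) (m : W.geomPoints) = σ • P - P →
        m ∈ (W.kernelOfReductionLocalDatum p v).plus := by
  obtain ⟨q, Φ, hq0, hq1, hsurj, hker, hΦσ, hred⟩ :=
    exists_tateUniformisation_localKernelOfReduction W v hsplit
  intro σ P m hm
  set L := AlgebraicClosure (v.adicCompletion K) with hL
  obtain ⟨u, rfl⟩ := hsurj P
  obtain ⟨u', rfl⟩ : ∃ u' : Lˣ, Additive.ofMul u' = u := ⟨Additive.toMul u, ofMul_toMul u⟩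
  obtain ⟨k, hk⟩ := (AddCommGroup.mem_primaryComponent).1 m.2
  set ζ : Lˣ :=
    Units.map (Field.absoluteGaloisGroup.toAlgEquiv (v.adicCompletion K) σ : L →* L) u' * u'⁻¹
    with hζdef
  have hζΦ : Φ (Additive.ofMul ζ) = pointsMap W (v.adicCompletion K) (m : W.geomPoints) := by
    rw [hm, hζdef, ofMul_mul, ofMul_inv, map_add, map_neg, ← hΦσ σ u', sub_eq_add_neg]
  have h0 : Φ (Additive.ofMul (ζ ^ p ^ k)) = 0 := by
    rw [ofMul_pow, map_nsmul, hζΦ, ← map_nsmul, hk, map_zero]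
  obtain ⟨a, ha⟩ := (hker _).1 h0
  -- `|ζ|_v = 1`, `|q|_v < 1` force `a = 0`, i.e. `ζ^{p^k} = 1`
  have hw := coe_spectralValuation v
  set w := v.spectralValuation with hw_def
  have hu0 : w (u' : L) ≠ 0 := (map_ne_zero w).2 u'.ne_zero
  have hwζ : w (ζ : L) = 1 := by
    rw [hζdef, Units.val_mul, map_mul, Units.coe_map, MonoidHom.coe_coe,
      ← Field.absoluteGaloisGroup.smul_def, spectralValuation_smul hw, Units.val_inv_eq_inv_val,
      map_inv₀, mul_inv_cancel₀ hu0]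
  have hq' : algebraMap (v.adicCompletion K) L q ≠ 0 :=
    (map_ne_zero_iff _ (algebraMap (v.adicCompletion K) L).injective).2 hq0
  have hwq0 : 0 < w (algebraMap (v.adicCompletion K) L q) := zero_lt_iff.2 ((map_ne_zero w).2 hq')
  have hwq : w (algebraMap (v.adicCompletion K) L q) < 1 := by
    rw [← NNReal.coe_lt_coe, coe_spectralValuation_algebraMap hw, NNReal.coe_one]
    exact Valued.toNormedField.norm_lt_one_iff.mpr hq1
  have hpow : w (algebraMap (v.adicCompletion K) L q) ^ a =
      w (algebraMap (v.adicCompletion K) L q) ^ (0 : ℤ) := by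
    rw [zpow_zero, ← map_zpow₀, ← ha, Units.val_pow_eq_pow_val, map_pow, hwζ, one_pow]
  have ha0 : a = 0 := (zpow_right_strictAnti₀ hwq0 hwq).injective hpow
  rw [ha0, zpow_zero, Units.val_pow_eq_pow_val] at ha
  -- a `p`-power root of unity is a principal unit at residue characteristic `p`
  have hpmem : ((p : ℕ) : v.adicCompletionIntegers K) ∈
      IsLocalRing.maximalIdeal (v.adicCompletionIntegers K) := by
    have h := (algebraMap_mem_maximalIdeal_adicCompletionIntegers_iff (v := v) ((p : ℕ) : 𝓞 K)).mpr hpv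
    simpa only [map_natCast] using h
  have hvp : w ((p : ℕ) : L) < 1 := by
    have hcoe : (((p : ℕ) : v.adicCompletionIntegers K) : v.adicCompletion K) = (p : v.adicCompletion K) := by
      norm_cast
    have e : ((p : ℕ) : L) = algebraMap (v.adicCompletion K) L
        (((p : ℕ) : v.adicCompletionIntegers K) : v.adicCompletion K) := by
      rw [hcoe, map_natCast]
    rw [e, ← NNReal.coe_lt_coe, coe_spectralValuation_algebraMap hw, NNReal.coe_one,
      Valued.toNormedField.norm_lt_one_iff]
    exact mem_maximalIdeal_adicCompletionIntegers_iff.mp hpmem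
  have hζ1 : w ((ζ : L) - 1) < 1 :=
    valuation_sub_one_lt_one_of_pow_prime_pow w hvp hwζ.le k
      (by rw [ha, sub_self, map_zero]; exact zero_lt_one)
  rw [WeierstrassCurve.mem_kernelOfReductionLocalDatum_plus_iff, ← hζΦ]
  exact hred ζ hζ1

/-- **KS(v) at a split multiplicative `v ∣ p` — `Im κ ⊆ Im λ` for `C_v = E[p^∞] ∩ E₁(K̄_v)`, PROVED**:
for every subgroup `H ≤ Γ_K` (fixed field `L`, local field `K = L_w K_v` at the chosen place), the
classes of `H¹(H, E[p^∞])` that are KUMMER at the place above `v` (`W.localKerOver p H K_v`) satisfy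
the STRICT condition there for the kernel-of-reduction datum
(`(W.kernelOfReductionLocalDatum p v).strictKer H`). This is the hypothesis `hKS` of x9's readout
`…ReadoutOrdinaryLocalKummerStrict…exists_grMk_eq_coboundary_of_localKerOver_le_strictKer` and of the
twin's `…MultiplicativeThreeProofs` version, at split multiplicative places.
[cite: GreenbergLNM1716, §2 pp. 75–76] [cite: SilvermanATAEC1994, Thm. V.3.1 (c),(d), §V.4, Thm. V.5.3] -/
theorem localKerOver_le_strictKer_kernelOfReduction_of_hasSplitMultiplicativeReductionAt
    (hpv : ((p : ℕ) : 𝓞 K) ∈ v.asIdeal) (hsplit : W.HasSplitMultiplicativeReductionAt v)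
    (H : Subgroup (absoluteGaloisGroup K)) :
    W.localKerOver p H (v.adicCompletion K) ≤ (W.kernelOfReductionLocalDatum p v).strictKer H :=
  localKerOver_le_strictKer_of_kummer_all W p H (W.kernelOfReductionLocalDatum p v)
    (kummer_all_kernelOfReductionLocalDatum_of_hasSplitMultiplicativeReductionAt W p hpv hsplit)

end Summit.BirchSwinnertonDyer.BirchSwinnertonDyer.Theorems.UniversalToricDescentKummerStrictSplitMultiplicative

end
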